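import Literature.NumberTheory.ComplexMultiplication.PrimePowerBlockNondegenerate
import Literature.AlgebraicGeometry.Pohlmann1968.NondegenerateCMTypeHodgeConjecture
import Literature.AlgebraicGeometry.ComplexMultiplication.SimpleIffPrimitiveCMType
import HarnessLib

/-!
# Simple CM abelian varieties of prime-power dimension `p^m` whose CM field contains an imaginary quadratic field:
# a CM type of weight prime to `p` gives the Hodge conjecture for the variety and ALL its powers

COR-CM (cell `pub-hodgecm2`), literature seat `lit-deligne-3` (gen 11, claim PRIME-POWER-WEIGHT), count-neutral
own lane; the abelian-variety reading of `CorCM/PrimePowerBlock/Nondegenerate.lean` (Dodson 1987 Prop. 4.1 in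
prime-power form: a CM type of a CM field `K ⊇ k`, `[K : k] = p^m`, whose weight over `k` is prime to `p` — and
`≠ p^m/2` — is NONDEGENERATE).  KERNEL ONLY: theorems; no definition, no named fact, no `sorry`.  HC_CM is NOT
proved and nothing here implies it: these are NAMED SUB-CLASSES of CM abelian varieties.

Setting: `K` a CM field of degree `2p^m` (`p` prime) containing an imaginary quadratic field — recorded, as in
`Literature/…/ConstantWeightCriterionQuadraticSubfield.lean`, by a CM type `Φ₀` of `K` whose reflex field (read in
a Galois CM field `L ⊇ K`) is quadratic, i.e. the type induced from `k`; or by an explicit `k : k₀ →+* K` with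
`[k₀ : ℚ] = 2` (`Φ₀ = inducedCMType k (single ψ₀)`) —, `Φ` a CM type of `K` of weight `w = |Φ₀ ∖ Φ|` with `p ∤ w`
and `2w ≠ p^m` (automatic for `p` odd), `(A, ι, θ)` ANY realisation of `(K; Φ)` on `H¹` (`IsCMTypeRealisation`;
such realisations exist, tree `CorCM.cmAbelianVarietyRealised_holds`).  Then (Pohlmann–White–Hazama for
nondegenerate types, tree `IsNondegenerate.hodgeConjectureFor_pow` [Gordon1999HodgeAVSurvey, Thm. 6.4, §9.3]):

* `isSimple` — `A` is SIMPLE, of dimension `p^m` (`dim_eq`) (nondegenerate ⟹ primitive, Shimura §8.2 Prop. 26);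
* `hodgeClassSpan_pow_eq_divisorClassesSpan` — `Bⁿ(Aʳ) ⊗ ℂ = Dⁿ(Aʳ) ⊗ ℂ` for all `r, n`: no exceptional Hodge class
  on any power;
* **`hodgeConjectureFor_pow`**, `hodgeConjectureFor` — the Hodge conjecture for `A` and for every power `Aʳ`,
  UNCONDITIONALLY; `…_of_odd` (no side condition), `…_of_ringHom(_of_odd)` (explicit `k : k₀ →+* K`);
* **`hodgeConjectureFor_pow_of_finrank_eq_eighteen`** — the printed case [Dodson1987, Prop. 4.1]: simple CM
  abelian `9`-folds whose CM field (degree `18`) contains an imaginary quadratic field, type of weight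
  `w ∈ {1, 2, 4, 5, 7, 8}` over it: HC for all powers.

Examples of fields covered (any totally real `K₀` of degree `p^m`, any imaginary quadratic `k`, `K = kK₀`):
`ℚ(ζ₂₇) ⊇ ℚ(√−3)` (`p^m = 9`; the types of weight `3, 6` include Dodson's degenerate ones, tree
`CorCM.CyclicComposite.exists_simple_exceptional_realisation_twentySeven`), `ℚ(ζ₈₁)`, `ℚ(√−d, ζ₇ + ζ₇⁻¹, …)`.

## References
* [Dodson1987] B. Dodson, J. Algebra 111 (1987), §4.1 Prop. 4.1 (p. 67).
* [Gordon1999HodgeAVSurvey] B. B. Gordon, *A survey of the Hodge conjecture for abelian varieties*, Thm. 6.4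
  (Hazama), §9.3 (White), §9.4.
* [Shimura1998] G. Shimura, *Abelian varieties with complex multiplication and modular functions*, §8.2 Prop. 26.

Provenance: Literature home (namespace `Literature.AlgebraicGeometry.ComplexMultiplication.PrimePowerBlock`) of the Summits-side `CorCM/PrimePowerBlock/Hodge` (cell `pub-hodgecm2`, COR-CM; all its imports are `Literature/`, Mathlib and the already re-homed `Nondegenerate`), which `Literature/` may not import; theorems only, no named fact, no definition. Nothing here bears on `HC_CM`. Lane `lit-hodgefound` (Layer A3: CM types, their Kubota ranks and Galois combinatorics), seat p20.
-/

set_option autoImplicit false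

open _root_.CategoryTheory NumberField

namespace Literature.AlgebraicGeometry.ComplexMultiplication.PrimePowerBlock

open Literature.NumberTheory.ComplexMultiplication.PrimePowerBlock

open Literature.NumberTheory.ComplexMultiplication
open Literature.AlgebraicGeometry.Motives (AbelianVariety CMType)
open Literature.AlgebraicGeometry.HodgeTheory
open Literature.AlgebraicGeometry.ComplexMultiplication (IsCMTypeRealisation isSimple_iff_isPrimitive)
open Literature.AlgebraicGeometry.VanGeemen1994 (hodgeClassSpan)
open Literature.Barriers.HodgeConjecture (divisorClassesSpan)
open Literature.AlgebraicGeometry.Pohlmann1968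

variable {K : Type} [Field K] [NumberField K] [IsCMField K]
variable {L : Type} [Field L] [NumberField L] [IsCMField L] [IsGalois ℚ L]
variable {Φ : CMType K} {A : AbelianVariety ℂ} {ι : 𝓞 K →+* End A} {θ : K →+* Module.End ℂ (complexBetti A.X 1)}

/-! ### §1 Over a block `Φ₀` (a CM type of quadratic reflex field) -/

section Block

/-- **The realisations are SIMPLE**: a type of weight prime to `p` (and `≠ p^m/2`) over the imaginary quadratic
subfield is nondegenerate, hence primitive, hence its abelian varieties are simple (Shimura §8.2 Prop. 26).
[cite: Dodson1987, Prop. 4.1] [cite: Shimura1998, §8.2 Prop. 26] -/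
theorem isSimple (j : K →ₐ[ℚ] L) (ιL : L →+* ℂ) (Φ₀ : CMType K)
    (h2 : Module.finrank ℚ (reflexField ℚ L (algValuedIn ιL Φ₀.1)) = 2) {p m : ℕ} (hp : p.Prime)
    (hK : Module.finrank ℚ K = 2 * p ^ m) (hf : ¬ p ∣ (Φ₀.1 \ Φ.1).ncard) (hw : 2 * (Φ₀.1 \ Φ.1).ncard ≠ p ^ m)
    (hA : IsCMTypeRealisation Φ A ι θ) (φ₀ : K →+* ℂ) : A.IsSimple :=
  (isSimple_iff_isPrimitive hA φ₀).2
    ((isNondegenerate_of_prime_pow_of_not_dvd j ιL Φ₀ Φ h2 hp hK hf hw).isPrimitive φ₀)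

omit [IsCMField K] in
/-- **… of dimension `p^m`.** [cite: Dodson1987, Prop. 4.1] -/
theorem dim_eq {p m : ℕ} (hK : Module.finrank ℚ K = 2 * p ^ m) (hA : IsCMTypeRealisation Φ A ι θ) :
    A.dim = p ^ m := by
  have hd : A.dim = Module.finrank ℚ K / 2 := Literature.AlgebraicGeometry.Motives.schemeDim_eq_holds hA.1
  rw [hd, hK]; omega

/-- **No exceptional Hodge classes on any power**: `Bⁿ(Aʳ) ⊗ ℂ = Dⁿ(Aʳ) ⊗ ℂ` for every realisation of a type of
weight prime to `p` (and `≠ p^m/2`) over the imaginary quadratic subfield, `[K : ℚ] = 2p^m`.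
[cite: Dodson1987, Prop. 4.1] [cite: Gordon1999HodgeAVSurvey, Thm. 6.4 and §9.3] -/
theorem hodgeClassSpan_pow_eq_divisorClassesSpan (j : K →ₐ[ℚ] L) (ιL : L →+* ℂ) (Φ₀ : CMType K)
    (h2 : Module.finrank ℚ (reflexField ℚ L (algValuedIn ιL Φ₀.1)) = 2) {p m : ℕ} (hp : p.Prime)
    (hK : Module.finrank ℚ K = 2 * p ^ m) (hf : ¬ p ∣ (Φ₀.1 \ Φ.1).ncard) (hw : 2 * (Φ₀.1 \ Φ.1).ncard ≠ p ^ m)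
    (hA : IsCMTypeRealisation Φ A ι θ) (r n : ℕ) :
    hodgeClassSpan (⨁ fun _ : Fin r => A).dim (⨁ fun _ : Fin r => A).X n =
      divisorClassesSpan (⨁ fun _ : Fin r => A).X (⨁ fun _ : Fin r => A).dim n :=
  (isNondegenerate_of_prime_pow_of_not_dvd j ιL Φ₀ Φ h2 hp hK hf hw).hodgeClassSpan_pow_eq_divisorClassesSpan
    hA r n

/-- **The Hodge conjecture for ALL POWERS** of every realisation of a CM type of weight prime to `p` (and
`≠ p^m/2`) over the imaginary quadratic subfield, `[K : ℚ] = 2p^m` — UNCONDITIONAL.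
[cite: Dodson1987, Prop. 4.1] [cite: Gordon1999HodgeAVSurvey, Thm. 6.4 and §9.3] -/
theorem hodgeConjectureFor_pow (j : K →ₐ[ℚ] L) (ιL : L →+* ℂ) (Φ₀ : CMType K)
    (h2 : Module.finrank ℚ (reflexField ℚ L (algValuedIn ιL Φ₀.1)) = 2) {p m : ℕ} (hp : p.Prime)
    (hK : Module.finrank ℚ K = 2 * p ^ m) (hf : ¬ p ∣ (Φ₀.1 \ Φ.1).ncard) (hw : 2 * (Φ₀.1 \ Φ.1).ncard ≠ p ^ m)
    (hA : IsCMTypeRealisation Φ A ι θ) (r : ℕ) :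
    HodgeConjectureFor (⨁ fun _ : Fin r => A).dim (⨁ fun _ : Fin r => A).X :=
  (isNondegenerate_of_prime_pow_of_not_dvd j ιL Φ₀ Φ h2 hp hK hf hw).hodgeConjectureFor_pow hA r

/-- … and for `A` itself. [cite: Dodson1987, Prop. 4.1] [cite: Gordon1999HodgeAVSurvey, §9.3] -/
theorem hodgeConjectureFor (j : K →ₐ[ℚ] L) (ιL : L →+* ℂ) (Φ₀ : CMType K)
    (h2 : Module.finrank ℚ (reflexField ℚ L (algValuedIn ιL Φ₀.1)) = 2) {p m : ℕ} (hp : p.Prime)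
    (hK : Module.finrank ℚ K = 2 * p ^ m) (hf : ¬ p ∣ (Φ₀.1 \ Φ.1).ncard) (hw : 2 * (Φ₀.1 \ Φ.1).ncard ≠ p ^ m)
    (hA : IsCMTypeRealisation Φ A ι θ) : HodgeConjectureFor A.dim A.X :=
  (isNondegenerate_of_prime_pow_of_not_dvd j ιL Φ₀ Φ h2 hp hK hf hw).hodgeConjectureFor hA

/-- **`p` odd: the Hodge conjecture for all powers**, weight prime to `p`, no side condition.
[cite: Dodson1987, Prop. 4.1] [cite: Gordon1999HodgeAVSurvey, Thm. 6.4 and §9.3] -/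
theorem hodgeConjectureFor_pow_of_odd (j : K →ₐ[ℚ] L) (ιL : L →+* ℂ) (Φ₀ : CMType K)
    (h2 : Module.finrank ℚ (reflexField ℚ L (algValuedIn ιL Φ₀.1)) = 2) {p m : ℕ} (hp : p.Prime) (hp2 : p ≠ 2)
    (hK : Module.finrank ℚ K = 2 * p ^ m) (hf : ¬ p ∣ (Φ₀.1 \ Φ.1).ncard) (hA : IsCMTypeRealisation Φ A ι θ)
    (r : ℕ) : HodgeConjectureFor (⨁ fun _ : Fin r => A).dim (⨁ fun _ : Fin r => A).X :=
  (isNondegenerate_of_prime_pow_of_not_dvd_of_odd j ιL Φ₀ Φ h2 hp hp2 hK hf).hodgeConjectureFor_pow hA r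

/-- **`p` odd: the Hodge conjecture for `A`**, weight prime to `p`. [cite: Dodson1987, Prop. 4.1]
[cite: Gordon1999HodgeAVSurvey, §9.3] -/
theorem hodgeConjectureFor_of_odd (j : K →ₐ[ℚ] L) (ιL : L →+* ℂ) (Φ₀ : CMType K)
    (h2 : Module.finrank ℚ (reflexField ℚ L (algValuedIn ιL Φ₀.1)) = 2) {p m : ℕ} (hp : p.Prime) (hp2 : p ≠ 2)
    (hK : Module.finrank ℚ K = 2 * p ^ m) (hf : ¬ p ∣ (Φ₀.1 \ Φ.1).ncard) (hA : IsCMTypeRealisation Φ A ι θ) :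
    HodgeConjectureFor A.dim A.X :=
  (isNondegenerate_of_prime_pow_of_not_dvd_of_odd j ιL Φ₀ Φ h2 hp hp2 hK hf).hodgeConjectureFor hA

/-- **Dodson 1987 Prop. 4.1, read on the abelian varieties: simple CM abelian `9`-folds whose CM field contains an
imaginary quadratic field, type of weight prime to `3` over it — the Hodge conjecture for ALL POWERS**,
unconditionally (`[K : ℚ] = 18`; for `K/ℚ` abelian this is the printed "type on `⟨ρ⟩ × R₀`, `R₀` regular of degree
`9`, weight relatively prime to `3` ⟹ nondegenerate" + White–Hazama). [cite: Dodson1987, Prop. 4.1]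
[cite: Gordon1999HodgeAVSurvey, Thm. 6.4 and §9.3] -/
theorem hodgeConjectureFor_pow_of_finrank_eq_eighteen (j : K →ₐ[ℚ] L) (ιL : L →+* ℂ) (Φ₀ : CMType K)
    (h2 : Module.finrank ℚ (reflexField ℚ L (algValuedIn ιL Φ₀.1)) = 2) (hK : Module.finrank ℚ K = 18)
    (hf : ¬ 3 ∣ (Φ₀.1 \ Φ.1).ncard) (hA : IsCMTypeRealisation Φ A ι θ) (r : ℕ) :
    HodgeConjectureFor (⨁ fun _ : Fin r => A).dim (⨁ fun _ : Fin r => A).X :=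
  (isNondegenerate_of_finrank_eq_eighteen j ιL Φ₀ Φ h2 hK hf).hodgeConjectureFor_pow hA r

/-- … and `Bⁿ(Aʳ) ⊗ ℂ = Dⁿ(Aʳ) ⊗ ℂ` on every power of these `9`-folds. [cite: Dodson1987, Prop. 4.1]
[cite: Gordon1999HodgeAVSurvey, Thm. 6.4 and §9.3] -/
theorem hodgeClassSpan_pow_eq_divisorClassesSpan_of_finrank_eq_eighteen (j : K →ₐ[ℚ] L) (ιL : L →+* ℂ)
    (Φ₀ : CMType K) (h2 : Module.finrank ℚ (reflexField ℚ L (algValuedIn ιL Φ₀.1)) = 2)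
    (hK : Module.finrank ℚ K = 18) (hf : ¬ 3 ∣ (Φ₀.1 \ Φ.1).ncard) (hA : IsCMTypeRealisation Φ A ι θ) (r n : ℕ) :
    hodgeClassSpan (⨁ fun _ : Fin r => A).dim (⨁ fun _ : Fin r => A).X n =
      divisorClassesSpan (⨁ fun _ : Fin r => A).X (⨁ fun _ : Fin r => A).dim n :=
  (isNondegenerate_of_finrank_eq_eighteen j ιL Φ₀ Φ h2 hK hf).hodgeClassSpan_pow_eq_divisorClassesSpan hA r n

end Block

/-! ### §2 Over an explicit imaginary quadratic subfield `k : k₀ →+* K` -/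

section ImaginaryQuadratic

variable {k₀ : Type} [Field k₀] [NumberField k₀] [IsTotallyComplex k₀]

/-- **`K ⊇ k`, `[K : k] = p^m`, weight `|{φ ∉ Φ | φ ∘ k = ψ₀}|` prime to `p` and `≠ p^m/2`: the Hodge conjecture for
all powers of every realisation of `(K; Φ)`.** [cite: Dodson1987, Prop. 4.1]
[cite: Gordon1999HodgeAVSurvey, Thm. 6.4 and §9.3] -/
theorem hodgeConjectureFor_pow_of_ringHom (hk2 : Module.finrank ℚ k₀ = 2) (k : k₀ →+* K) (j : K →ₐ[ℚ] L)
    (ιL : L →+* ℂ) (ψ₀ : k₀ →+* ℂ) {p m : ℕ} (hp : p.Prime) (hK : Module.finrank ℚ K = 2 * p ^ m)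
    (hf : ¬ p ∣ {φ : K →+* ℂ | φ ∉ Φ.1 ∧ φ.comp k = ψ₀}.ncard)
    (hw : 2 * {φ : K →+* ℂ | φ ∉ Φ.1 ∧ φ.comp k = ψ₀}.ncard ≠ p ^ m) (hA : IsCMTypeRealisation Φ A ι θ) (r : ℕ) :
    HodgeConjectureFor (⨁ fun _ : Fin r => A).dim (⨁ fun _ : Fin r => A).X :=
  (isNondegenerate_of_prime_pow_of_ringHom hk2 k j ιL ψ₀ Φ hp hK hf hw).hodgeConjectureFor_pow hA r

/-- **`K ⊇ k`, `[K : k] = p^m`, `p` odd, weight prime to `p`: the Hodge conjecture for all powers.**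
[cite: Dodson1987, Prop. 4.1] [cite: Gordon1999HodgeAVSurvey, Thm. 6.4 and §9.3] -/
theorem hodgeConjectureFor_pow_of_ringHom_of_odd (hk2 : Module.finrank ℚ k₀ = 2) (k : k₀ →+* K)
    (j : K →ₐ[ℚ] L) (ιL : L →+* ℂ) (ψ₀ : k₀ →+* ℂ) {p m : ℕ} (hp : p.Prime) (hp2 : p ≠ 2)
    (hK : Module.finrank ℚ K = 2 * p ^ m) (hf : ¬ p ∣ {φ : K →+* ℂ | φ ∉ Φ.1 ∧ φ.comp k = ψ₀}.ncard)
    (hA : IsCMTypeRealisation Φ A ι θ) (r : ℕ) :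
    HodgeConjectureFor (⨁ fun _ : Fin r => A).dim (⨁ fun _ : Fin r => A).X :=
  (isNondegenerate_of_prime_pow_of_ringHom_of_odd hk2 k j ιL ψ₀ Φ hp hp2 hK hf).hodgeConjectureFor_pow hA r

/-- **… and for `A` itself** (`p` odd). [cite: Dodson1987, Prop. 4.1] [cite: Gordon1999HodgeAVSurvey, §9.3] -/
theorem hodgeConjectureFor_of_ringHom_of_odd (hk2 : Module.finrank ℚ k₀ = 2) (k : k₀ →+* K)
    (j : K →ₐ[ℚ] L) (ιL : L →+* ℂ) (ψ₀ : k₀ →+* ℂ) {p m : ℕ} (hp : p.Prime) (hp2 : p ≠ 2)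
    (hK : Module.finrank ℚ K = 2 * p ^ m) (hf : ¬ p ∣ {φ : K →+* ℂ | φ ∉ Φ.1 ∧ φ.comp k = ψ₀}.ncard)
    (hA : IsCMTypeRealisation Φ A ι θ) : HodgeConjectureFor A.dim A.X :=
  (isNondegenerate_of_prime_pow_of_ringHom_of_odd hk2 k j ιL ψ₀ Φ hp hp2 hK hf).hodgeConjectureFor hA

/-- **Simplicity over an explicit `k`**: the realisations are simple abelian varieties of dimension `p^m` (`p` odd,
weight prime to `p`). [cite: Dodson1987, Prop. 4.1] [cite: Shimura1998, §8.2 Prop. 26] -/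
theorem isSimple_of_ringHom_of_odd (hk2 : Module.finrank ℚ k₀ = 2) (k : k₀ →+* K) (j : K →ₐ[ℚ] L)
    (ιL : L →+* ℂ) (ψ₀ : k₀ →+* ℂ) {p m : ℕ} (hp : p.Prime) (hp2 : p ≠ 2) (hK : Module.finrank ℚ K = 2 * p ^ m)
    (hf : ¬ p ∣ {φ : K →+* ℂ | φ ∉ Φ.1 ∧ φ.comp k = ψ₀}.ncard) (hA : IsCMTypeRealisation Φ A ι θ)
    (φ₀ : K →+* ℂ) : A.IsSimple :=
  (isSimple_iff_isPrimitive hA φ₀).2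
    ((isNondegenerate_of_prime_pow_of_ringHom_of_odd hk2 k j ιL ψ₀ Φ hp hp2 hK hf).isPrimitive φ₀)

end ImaginaryQuadratic

end Literature.AlgebraicGeometry.ComplexMultiplication.PrimePowerBlock
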